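import Literature.AnabelianGeometry.SemiGraphs.SubgroupPresentationArithLevels
import Literature.AnabelianGeometry.SemiGraphs.TemperedClosedSubgroupCompact
import HarnessLib

/-!
# [SemiAnbd] §5 p. 65: the arithmetic decomposition groups are COMPACT — stabilisers of vertices of
# the arithmetic coset trees have finite image modulo the arithmetic level kernels, given the
# continuity binder `hK1′`

Mochizuki, *Semi-graphs of anabelioids*, Publ. RIMS **42** (2006), §5 p. 65 / Rmk 5.3.1 ("`Π^temp_{𝔊,v}`
… compact"), Prop 5.2 (iv) p. 64, Thm 5.4 p. 66, kurims `paper:url-f33ace170ff4`.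
[cite: MochizukiSemiAnbd2006, Rmk 5.3.1, p. 65]

PROOF-ONLY file of producer row T54-B (GAP-LEDGER G-w4d053-1; abc-iut-w4-d053, package owner), the
LEVEL-B binder `hVc` of the Thm 5.4 (i)∧(ii) umbrella in the currency of abc-iut-L3-d4's arithmetic tower
(`SemiGraph.SubgroupPresentation`, `cosetGraph`, `arithAct`, `levelKer`; SubgroupPresentation*.lean) and
abc-iut-L3-d2's tempered topology on `Π^temp_𝔊` (basis `levelKer (N n) ⊓ aug⁻¹ U`,
ArithTemperedGroupTopology.lean), closing the sub-piece (d) «centralMod» of abc-iut-w4-d040's INFO-1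
on ImmersionLiftUnique.lean: ALL FOUR factors of `levelKer` at once.

* `SemiGraph.SubgroupPresentation.finite_image_quotient_levelKer_of_fixes` — the KEY finiteness: let
  `S ⊆ E = Π^temp_𝔊` fix a vertex `H_w y L` of the level-`L` coset semi-graph under `arithAct`, with
  `H_w` compact, `L` open normal `Φ`-stable, `ker aug ≤ range ι` (exactness), `Π_A` compact, and
  `aug (levelKer L)` OPEN (the continuity binder `hK1′` of `exists_arithTemperedGroup_of_kernelSeq`).
  Then the image of `S` in `E / levelKer L` is FINITE.  (Proof: modulo the finitely many classes of
  `aug S` in `Π_A / aug(levelKer L)`, an element of `S` is `ι(g) · e` with `e ∈ levelKer L` and `g ∈ Γ`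
  whose DECK transformation fixes `H_w y L`, i.e. `g ∈ L · y⁻¹ H_w y`; and `y⁻¹ H_w y` has finite
  image modulo the open `L ≤ ι⁻¹(levelKer L)`.)
* `…finite_image_quotient_levelKer_inf_comap_of_fixes` — the same modulo a basic open subgroup
  `levelKer L ⊓ aug⁻¹ U`, `U` open in the compact `Π_A` (`finite_image_quotient_inf/_comap`).
* `…isCompact_of_fixes_vertices` — CONSEQUENCE (`IsTempered.isCompact_of_isClosed_of_hasBasis`): in
  the tempered topology with basis `levelKer (N n) ⊓ aug⁻¹ U`, a CLOSED subset of `Π^temp_𝔊` fixing,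
  at every level `n`, some vertex of the level-`N n` coset tree is COMPACT — `hVc` for the arithmetic
  decomposition groups `Π^temp_{𝔊,v} = Stab(x̃_v)` of pro-vertices (closedness:
  `isClosed_setOf_forall_fixes`, the level kernels being open), modulo `hK1′` alone.

Nothing here asserts a statement of [SemiAnbd] beyond what is proved; typed ≠ proved; no side taken on
[IUTchIII] Cor 3.12.
-/

namespace Literature.AnabelianGeometry.SemiGraphs

namespace SemiGraph

namespace SubgroupPresentation

open CategoryTheory Topology Filter
open scoped Pointwise

universe u v w

variable {𝔾 : SemiGraph.{u}} {Γ : Type u} [Group Γ] {E : Type v} [Group E]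
  (P : SubgroupPresentation 𝔾 Γ) {Φ : E →* MulAut Γ} {σ : E →* Aut 𝔾}
  (hP : P.IsArithCompatible Φ σ) (L : Subgroup Γ) [L.Normal]
  (hL : ∀ (e : E) (x : Γ), x ∈ L → Φ e x ∈ L)
  {PA : Type w} [Group PA] (aug : E →* PA)

/-- Deck stabilisers of coset vertices: if the deck transformation of `g ∈ Γ` fixes `H_w y L`, then
`g ∈ L · (y⁻¹ H_w y)`, i.e. `g = l · y⁻¹ h y` with `l ∈ L`, `h ∈ H_w`.
[cite: MochizukiSemiAnbd2006, Thm 3.7(iii) p.41] -/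
theorem exists_eq_mul_conj_of_deckAct_vMk_eq (w : 𝔾.Vertex) (y g : Γ)
    (hg : (P.deckAct L g).hom.vertexMap (P.vMk L w y) = P.vMk L w y) :
    ∃ l ∈ L, ∃ h ∈ P.H w, g = l * (y⁻¹ * h * y) := by
  rw [deckAct_vertexMap_vMk] at hg
  have hmk : DoubleCoset.mk (P.H w) L (y * g⁻¹) = DoubleCoset.mk (P.H w) L y :=
    eq_of_heq (Sigma.mk.inj hg).2
  obtain ⟨h, hh, l, hl, hyl⟩ := (DoubleCoset.eq _ _ _ _).1 hmk
  -- `y = h * (y * g⁻¹) * l` ⇒ `g = l * y⁻¹ * h * y`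
  refine ⟨l, hl, h, hh, ?_⟩
  have h2 : y * g⁻¹ = h⁻¹ * y * l⁻¹ := by
    rw [show h⁻¹ * y * l⁻¹ = h⁻¹ * (h * (y * g⁻¹) * l) * l⁻¹ by rw [← hyl]]
    group
  calc g = (y * g⁻¹)⁻¹ * y := by group
    _ = (h⁻¹ * y * l⁻¹)⁻¹ * y := by rw [h2]
    _ = l * (y⁻¹ * h * y) := by group

/-- **Finite image modulo the arithmetic level kernel** ([SemiAnbd] p. 65, compactness of
`Π^temp_{𝔊,v}`, in tower currency): if `S ⊆ E` fixes the vertex `H_w y L` of the level-`L` coset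
semi-graph, `H_w` is compact and `L` open, `ker aug ≤ range ι`, `Π_A` is compact and the image
`aug (levelKer L)` is OPEN (the continuity binder `hK1′`), then the image of `S` in `E / levelKer L` is
finite. [cite: MochizukiSemiAnbd2006, Rmk 5.3.1, p. 65] -/
theorem finite_image_quotient_levelKer_of_fixes [TopologicalSpace Γ] [IsTopologicalGroup Γ]
    [TopologicalSpace PA] [IsTopologicalGroup PA] [CompactSpace PA]
    (ι : Γ →* E) (hιΦ : ∀ g : Γ, Φ (ι g) = MulAut.conj g) (hισ : ∀ g : Γ, σ (ι g) = 1)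
    (hLopen : IsOpen (L : Set Γ)) (hexact : aug.ker ≤ ι.range)
    (hK1' : IsOpen (((P.levelKer hP L hL).map aug : Subgroup PA) : Set PA))
    (w : 𝔾.Vertex) (hHc : IsCompact (P.H w : Set Γ)) (y : Γ) (S : Set E)
    (hS : ∀ s ∈ S, (P.arithAct hP L hL s).hom.vertexMap (P.vMk L w y) = P.vMk L w y) :
    ((QuotientGroup.mk : E → E ⧸ P.levelKer hP L hL) '' S).Finite := by
  classical
  haveI hN : (P.levelKer hP L hL).Normal := P.levelKer_normal hP L hL
  set N := P.levelKer hP L hL with hNdef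
  set U : Subgroup PA := N.map aug with hUdef
  haveI : Finite (PA ⧸ U) := Subgroup.quotient_finite_of_isOpen U hK1'
  -- representatives in `S` of the classes of `aug S` modulo `U`
  have hrep : ∀ c : PA ⧸ U, ∃ r : E, (∃ s ∈ S, (QuotientGroup.mk (aug s) : PA ⧸ U) = c) →
      r ∈ S ∧ (QuotientGroup.mk (aug r) : PA ⧸ U) = c := by
    intro c
    by_cases hc : ∃ s ∈ S, (QuotientGroup.mk (aug s) : PA ⧸ U) = c
    · obtain ⟨s, hs, hsc⟩ := hc
      exact ⟨s, fun _ => ⟨hs, hsc⟩⟩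
    · exact ⟨1, fun h => (hc h).elim⟩
  choose r hr using hrep
  -- the classes of the conjugated vertex group `y⁻¹ H_w y` modulo `N`, a finite set
  let f : Γ → E ⧸ N := fun h => QuotientGroup.mk (ι (y⁻¹ * h * y))
  have hLN : ∀ l ∈ L, ι l ∈ N := fun l hl => P.le_comap_levelKer hP L hL ι hιΦ hισ hl
  have hfinH : (f '' (P.H w : Set Γ)).Finite := by
    haveI : CompactSpace (P.H w) := isCompact_iff_compactSpace.mp hHc
    let Lw : Subgroup (P.H w) := L.subgroupOf (P.H w)
    have hLw : IsOpen (Lw : Set (P.H w)) := hLopen.preimage continuous_subtype_val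
    haveI : Finite ((P.H w) ⧸ Lw) := Subgroup.quotient_finite_of_isOpen Lw hLw
    -- `f` depends only on the class modulo `L`
    have hfac : ∀ a b : P.H w, (QuotientGroup.mk a : (P.H w) ⧸ Lw) = QuotientGroup.mk b →
        f a = f b := by
      intro a b hab
      rw [QuotientGroup.eq] at hab
      have hab' : ((a : Γ)⁻¹ * b) ∈ L := hab
      change (QuotientGroup.mk (ι (y⁻¹ * a * y)) : E ⧸ N) = QuotientGroup.mk (ι (y⁻¹ * b * y))
      rw [QuotientGroup.eq, ← map_inv, ← map_mul]
      have : (y⁻¹ * (a : Γ) * y)⁻¹ * (y⁻¹ * b * y) = y⁻¹ * ((a : Γ)⁻¹ * b) * y⁻¹⁻¹ := by group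
      rw [this]
      exact hLN _ (‹L.Normal›.conj_mem _ hab' y⁻¹)
    refine (Set.finite_range (fun q : (P.H w) ⧸ Lw => f (Quotient.out q : P.H w))).subset ?_
    rintro _ ⟨h, hh, rfl⟩
    refine ⟨QuotientGroup.mk ⟨h, hh⟩, ?_⟩
    exact hfac _ ⟨h, hh⟩ (QuotientGroup.out_eq' _)
  -- the stabiliser of the vertex as a subgroup
  let St : Subgroup E :=
    { carrier := {e : E | (P.arithAct hP L hL e).hom.vertexMap (P.vMk L w y) = P.vMk L w y}
      one_mem' := by
        simp only [Set.mem_setOf_eq, map_one]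
        rfl
      mul_mem' := by
        intro a b ha hb
        simp only [Set.mem_setOf_eq] at ha hb ⊢
        rw [map_mul, Aut.Aut_mul_def, Iso.trans_hom, comp_vertexMap, Function.comp_apply, hb, ha]
      inv_mem' := by
        intro a ha
        simp only [Set.mem_setOf_eq] at ha ⊢
        have h : ((P.arithAct hP L hL a).hom ≫ (P.arithAct hP L hL a).inv).vertexMap (P.vMk L w y) =
            P.vMk L w y := by
          rw [Iso.hom_inv_id]
          rfl
        rw [comp_vertexMap, Function.comp_apply, ha] at h
        rw [map_inv, Aut.Aut_inv_def]
        exact h }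
  have hSt : ∀ s ∈ S, s ∈ St := fun s hs => hS s hs
  have hNSt : N ≤ St := by
    intro e he
    change (P.arithAct hP L hL e).hom.vertexMap (P.vMk L w y) = P.vMk L w y
    rw [((P.mem_levelKer_iff hP L hL).1 he).1]
    rfl
  -- main inclusion
  refine ((Set.finite_univ.image2 (fun (c : PA ⧸ U) (z : E ⧸ N) =>
    (QuotientGroup.mk (r c) : E ⧸ N) * z) hfinH).subset ?_)
  rintro _ ⟨s, hs, rfl⟩
  set c : PA ⧸ U := QuotientGroup.mk (aug s) with hcdef
  obtain ⟨hrS, hrc⟩ := hr c ⟨s, hs, rfl⟩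
  -- `aug (r c)⁻¹ * aug s ∈ U = aug N`
  have hU : (aug (r c))⁻¹ * aug s ∈ U := QuotientGroup.eq.1 hrc
  obtain ⟨e, heN, he⟩ := hU
  -- `(r c)⁻¹ * s * e⁻¹ ∈ ker aug ≤ range ι`
  have hker : (r c)⁻¹ * s * e⁻¹ ∈ aug.ker := by
    rw [MonoidHom.mem_ker, map_mul, map_mul, map_inv, map_inv, he]
    group
  obtain ⟨g, hg⟩ := hexact hker
  -- the deck transformation of `g` fixes the vertex
  have hgSt : ι g ∈ St := by
    rw [hg]
    exact St.mul_mem (St.mul_mem (St.inv_mem (hSt _ hrS)) (hSt s hs)) (St.inv_mem (hNSt heN))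
  have hdeck : (P.deckAct L g).hom.vertexMap (P.vMk L w y) = P.vMk L w y := by
    rw [← P.arithAct_eq_deckAct_of_inner hP L hL (hιΦ g) (hισ g)]
    exact hgSt
  obtain ⟨l, hl, h, hh, hgl⟩ := P.exists_eq_mul_conj_of_deckAct_vMk_eq L w y g hdeck
  set k : Γ := y⁻¹ * h * y with hk
  -- `s = r c * ι g * e = r c * ι l * ι k * e`
  have hs_eq : s = r c * ι g * e := by
    rw [hg]; group
  refine ⟨c, Set.mem_univ _, f h, ⟨h, hh, rfl⟩, ?_⟩
  change (QuotientGroup.mk (r c) : E ⧸ N) * QuotientGroup.mk (ι k) = QuotientGroup.mk s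
  rw [hs_eq, hgl, map_mul ι l k, ← QuotientGroup.mk_mul, QuotientGroup.eq]
  -- `(r c * ι k)⁻¹ * (r c * (ι l * ι k) * e) ∈ N`
  have h1 : (r c * ι k)⁻¹ * (r c * (ι l * ι k) * e) = (ι k)⁻¹ * ι l * ι k * e := by group
  rw [h1]
  exact N.mul_mem (hN.conj_mem' _ (hLN l hl) _) heN

omit [L.Normal] in
/-- The same finiteness modulo a BASIC OPEN subgroup `levelKer L ⊓ aug⁻¹ U` of abc-iut-L3-d2's tempered
topology (`U` an open subgroup of the compact `Π_A`). [cite: MochizukiSemiAnbd2006, Rmk 5.3.1, p. 65] -/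
theorem finite_image_quotient_levelKer_inf_comap_of_fixes [L.Normal] [TopologicalSpace Γ]
    [IsTopologicalGroup Γ] [TopologicalSpace PA] [IsTopologicalGroup PA] [CompactSpace PA]
    (ι : Γ →* E) (hιΦ : ∀ g : Γ, Φ (ι g) = MulAut.conj g) (hισ : ∀ g : Γ, σ (ι g) = 1)
    (hLopen : IsOpen (L : Set Γ)) (hexact : aug.ker ≤ ι.range)
    (hK1' : IsOpen (((P.levelKer hP L hL).map aug : Subgroup PA) : Set PA))
    (w : 𝔾.Vertex) (hHc : IsCompact (P.H w : Set Γ)) (y : Γ) (S : Set E)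
    (hS : ∀ s ∈ S, (P.arithAct hP L hL s).hom.vertexMap (P.vMk L w y) = P.vMk L w y)
    (U : OpenNormalSubgroup PA) :
    ((QuotientGroup.mk : E → E ⧸ (P.levelKer hP L hL ⊓ U.toSubgroup.comap aug)) '' S).Finite := by
  haveI : Finite (PA ⧸ U.toSubgroup) := Subgroup.quotient_finite_of_isOpen _ U.isOpen'
  exact finite_image_quotient_inf
    (P.finite_image_quotient_levelKer_of_fixes hP L hL aug ι hιΦ hισ hLopen hexact hK1' w hHc y S hS)
    (finite_image_quotient_comap aug U.toSubgroup S)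

/-- Stabilisers of vertices of the coset semi-graphs under the arithmetic actions are CLOSED in any
group topology on `E` in which the level kernels are open. [cite: MochizukiSemiAnbd2006, Rmk 5.3.1, p. 65] -/
theorem isClosed_setOf_forall_fixes [TopologicalSpace E] [IsTopologicalGroup E]
    (N : ℕ → Subgroup Γ) [∀ n, (N n).Normal] (hN : ∀ (n : ℕ) (e : E) (x : Γ), x ∈ N n → Φ e x ∈ N n)
    (hKopen : ∀ n, IsOpen ((P.levelKer hP (N n) (hN n) : Subgroup E) : Set E))
    (x : ∀ n, (P.cosetGraph (N n)).Vertex) :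
    IsClosed {e : E | ∀ n, (P.arithAct hP (N n) (hN n) e).hom.vertexMap (x n) = x n} := by
  refine isClosed_setOf_forall_vertexMap_eq (fun n => P.arithAct hP (N n) (hN n)) (fun n => ?_) x
  refine Subgroup.isOpen_mono (fun e he => ?_) (hKopen n)
  rw [MonoidHom.mem_ker]
  exact ((P.mem_levelKer_iff hP (N n) (hN n)).1 he).1

/-- **`hVc` for the arithmetic decomposition groups, modulo the continuity binder `hK1′`** ([SemiAnbd]
p. 65: `Π^temp_{𝔊,v}` is compact): in a TEMPERED group topology on `E = Π^temp_𝔊` with basis of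
neighbourhoods of `1` the subgroups `levelKer (N n) ⊓ aug⁻¹ U` (abc-iut-L3-d2's
`exists_topology_arithTemperedGroup_of_kernelSeq`), for open normal `Φ`-stable levels `N n`, a compact
vertex group `H_w`, `ker aug ≤ range ι`, `Π_A` compact and `aug (levelKer (N n))` open for all `n`, every
CLOSED subset of `E` fixing at each level `n` some vertex of the level-`N n` coset semi-graph over `w` is
COMPACT. [cite: MochizukiSemiAnbd2006, Rmk 5.3.1, p. 65] -/
theorem isCompact_of_fixes_vertices [TopologicalSpace Γ] [IsTopologicalGroup Γ]
    [TopologicalSpace PA] [IsTopologicalGroup PA] [CompactSpace PA]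
    [TopologicalSpace E] [IsTopologicalGroup E] (hE : IsTempered E)
    (ι : Γ →* E) (hιΦ : ∀ g : Γ, Φ (ι g) = MulAut.conj g) (hισ : ∀ g : Γ, σ (ι g) = 1)
    (N : ℕ → Subgroup Γ) [∀ n, (N n).Normal] (hN : ∀ (n : ℕ) (e : E) (x : Γ), x ∈ N n → Φ e x ∈ N n)
    (hNopen : ∀ n, IsOpen (N n : Set Γ))
    (hb : (𝓝 (1 : E)).HasBasis (fun _ : ℕ × OpenNormalSubgroup PA => True)
      (fun nU => ((P.levelKer hP (N nU.1) (hN nU.1) ⊓ nU.2.toSubgroup.comap aug : Subgroup E) :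
        Set E)))
    (hexact : aug.ker ≤ ι.range)
    (hK1' : ∀ n, IsOpen (((P.levelKer hP (N n) (hN n)).map aug : Subgroup PA) : Set PA))
    (w : 𝔾.Vertex) (hHc : IsCompact (P.H w : Set Γ)) (y : ℕ → Γ) (S : Set E) (hS : IsClosed S)
    (hfix : ∀ s ∈ S, ∀ n, (P.arithAct hP (N n) (hN n) s).hom.vertexMap (P.vMk (N n) w (y n)) =
      P.vMk (N n) w (y n)) :
    IsCompact S :=
  hE.isCompact_of_isClosed_of_hasBasis hb hS fun nU _ =>
    P.finite_image_quotient_levelKer_inf_comap_of_fixes hP (N nU.1) (hN nU.1) aug ι hιΦ hισ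
      (hNopen nU.1) hexact (hK1' nU.1) w hHc (y nU.1) S (fun s hs => hfix s hs nU.1) nU.2

end SubgroupPresentation

end SemiGraph

end Literature.AnabelianGeometry.SemiGraphs
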